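/-
Width seat `ym-line-sgb-p1-w3` (gen 2), route `SteinGapBootstrap`, crux `ProbeCovFromPairLawG` (stmt-QuantumFields-23640; alias
`UProbeCovFromPairLaw`, 23800) — helper 2/3: admissible Gaussian test functions and the Gaussian side of the probe covariance.
-/
import Literature.MathematicalPhysics.QuantumFieldTheory.LatticeMaxwellBlockOU
import Summits.QuantumFields.YangMills.Theorems.EquipartitionCriticalityEquipartitionPinsProbeGaussianProfile
import HarnessLib

/-!
# `ProbeCovFromPairLawG` — helper 2: admissible Gaussian test functions and the Gaussian side

NOT THE CLAY GAP: route `SteinGapBootstrap` bears on the RECORD-label rung leaf R2ξ′ `WeakCouplingRates.XiPow` (an UPPER bound on the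
lattice mass gap of torus-limit states); this file is finite-dimensional calculus and a Gaussian computation.

On the block space `ι → κ → ℝ` (sup norm; for the crux `ι = ↥B`, `κ = Fin D`) and a set `S` of block labels, the test function
`h_S(y) = exp(-Σ_{p∈S} Σ_a (y p a)²)` is smooth with `Dh_S(y) = h_S(y) · A_S y`, `A_S = -2 Σ_{p∈S,a} π_{pa} ⊗ π_{pa}` (`π_{pa}` the
coordinate functionals) and `D²h_S(y)[v][w] = h_S(y)(A_S v w + (A_S y v)(A_S y w))`; with `m = |S|·|κ|`, `|A_S v w| ≤ 2m‖v‖‖w‖`,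
`|A_S y w| ≤ 2(Σ|y_{pa}|)‖w‖`, `(Σ|y_{pa}|)² ≤ m Σ y_{pa}²` and `q e^{-q} ≤ 1` give the GLOBAL bounds `‖Dh_S‖ ≤ m + 1`, `‖D²h_S‖ ≤ 6m`,
so `h_S / (6m+1)` is an admissible test function of the crux (`C^∞`, `‖∇h‖ ≤ 1`, `‖∇²h‖ ≤ 1`): `gaussTest_admissible`.
Gaussian side: under the block law `γ_B = latticeMaxwellBlockLaw B D` of the lattice-Maxwell curvature field (`d = 4`),
`Cov_{γ_B}(e^{-|y_p|²}, e^{-|y_q|²}) = 2^{-D}((1 − c²)^{-D/2} − 1)`, `c = curvatureTwoPoint p q`, and `0 ≤ ∫ e^{-|y_p|²} dγ_B ≤ 1`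
(`gauss_covariance_blockLaw`: the tree's `GaussianProfile.covariance_formula` along `integral_latticeMaxwellBlockLaw`).
References: E. Meckes, IMS Coll. 5 (2009) 153, §1 [Meckes2009]; C. Garban, A. Sepúlveda, IMRN 2023, §4 [GarbanSepulveda2023].
-/

set_option autoImplicit false

noncomputable section

open MeasureTheory
open Literature.MathematicalPhysics.QuantumLattice Literature.MathematicalPhysics.QuantumFieldTheory

namespace Summit.QuantumFields.YangMills.Theorems.SteinGapBootstrap

namespace ProbeCovFromPairLaw

/-! ### Calculus of the Gaussian test functions on `ι → κ → ℝ` -/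

section Test

variable {ι κ : Type*} [Fintype ι] [Fintype κ]

/-- The coordinate functional `y ↦ y p a` has norm at most `1` (sup norm): `|y p a| ≤ ‖y‖`. [folklore] -/
theorem abs_apply_apply_le_norm (y : ι → κ → ℝ) (p : ι) (a : κ) : |y p a| ≤ ‖y‖ :=
  (Real.norm_eq_abs _).symm.le.trans ((norm_le_pi_norm (y p) a).trans (norm_le_pi_norm y p))

variable (S : Finset ι)

/-- **First derivative of the quadratic form** `q_S(y) = Σ_{p∈S} Σ_a (y p a)²`: `Dq_S(y) = Σ 2 (y p a) π_{pa}`. [folklore] -/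
theorem hasFDerivAt_sqSum (y : ι → κ → ℝ) :
    HasFDerivAt (fun y : ι → κ → ℝ => ∑ p ∈ S, ∑ a, (y p a) ^ 2)
      (∑ p ∈ S, ∑ a, (2 * y p a) • ((ContinuousLinearMap.proj (R := ℝ) a).comp
        (ContinuousLinearMap.proj (R := ℝ) (φ := fun _ : ι => κ → ℝ) p))) y := by
  refine HasFDerivAt.fun_sum fun p _ => HasFDerivAt.fun_sum fun a _ => ?_
  have hπ : HasFDerivAt (fun y : ι → κ → ℝ => y p a) ((ContinuousLinearMap.proj (R := ℝ) a).comp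
        (ContinuousLinearMap.proj (R := ℝ) (φ := fun _ : ι => κ → ℝ) p)) y :=
    ((ContinuousLinearMap.proj (R := ℝ) a).comp
        (ContinuousLinearMap.proj (R := ℝ) (φ := fun _ : ι => κ → ℝ) p)).hasFDerivAt
  refine (hπ.pow 2).congr_fderiv ?_
  norm_num

omit [Fintype ι] in
/-- The linear field `A_S y = -2 Σ_{p∈S,a} (y p a) π_{pa}` (the value at `y` of the continuous linear map `-2 Σ π_{pa} ⊗ π_{pa}`) is
`-Dq_S(y)`. [folklore] -/
theorem linField_apply (y : ι → κ → ℝ) :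
    ((-2 : ℝ) • ∑ p ∈ S, ∑ a : κ, ((ContinuousLinearMap.proj (R := ℝ) a).comp
        (ContinuousLinearMap.proj (R := ℝ) (φ := fun _ : ι => κ → ℝ) p)).smulRight
        ((ContinuousLinearMap.proj (R := ℝ) a).comp
          (ContinuousLinearMap.proj (R := ℝ) (φ := fun _ : ι => κ → ℝ) p))) y = -∑ p ∈ S, ∑ a, (2 * y p a) • ((ContinuousLinearMap.proj (R := ℝ) a).comp
        (ContinuousLinearMap.proj (R := ℝ) (φ := fun _ : ι => κ → ℝ) p)) := by
  ext v
  simp [Finset.mul_sum, mul_assoc]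

omit [Fintype ι] in
/-- `A_S v w = -2 Σ_{p∈S,a} v_{pa} w_{pa}`. [folklore] -/
theorem linField_apply_apply (v w : ι → κ → ℝ) :
    ((-2 : ℝ) • ∑ p ∈ S, ∑ a : κ, ((ContinuousLinearMap.proj (R := ℝ) a).comp
        (ContinuousLinearMap.proj (R := ℝ) (φ := fun _ : ι => κ → ℝ) p)).smulRight
        ((ContinuousLinearMap.proj (R := ℝ) a).comp
          (ContinuousLinearMap.proj (R := ℝ) (φ := fun _ : ι => κ → ℝ) p))) v w = -2 * ∑ p ∈ S, ∑ a, v p a * w p a := by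
  simp [Finset.mul_sum]

/-- `|A_S v w| ≤ 2 |S||κ| ‖v‖ ‖w‖`. [folklore] -/
theorem abs_linField_apply_apply_le (v w : ι → κ → ℝ) :
    |((-2 : ℝ) • ∑ p ∈ S, ∑ a : κ, ((ContinuousLinearMap.proj (R := ℝ) a).comp
        (ContinuousLinearMap.proj (R := ℝ) (φ := fun _ : ι => κ → ℝ) p)).smulRight
        ((ContinuousLinearMap.proj (R := ℝ) a).comp
          (ContinuousLinearMap.proj (R := ℝ) (φ := fun _ : ι => κ → ℝ) p))) v w| ≤ 2 * (S.card * Fintype.card κ : ℝ) * ‖v‖ * ‖w‖ := by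
  rw [linField_apply_apply, abs_mul, abs_neg, abs_two]
  have h : |∑ p ∈ S, ∑ a, v p a * w p a| ≤ (S.card * Fintype.card κ : ℝ) * ‖v‖ * ‖w‖ := by
    refine (Finset.abs_sum_le_sum_abs _ _).trans ?_
    calc ∑ p ∈ S, |∑ a, v p a * w p a| ≤ ∑ p ∈ S, ∑ a, |v p a * w p a| :=
          Finset.sum_le_sum fun p _ => Finset.abs_sum_le_sum_abs _ _
      _ ≤ ∑ p ∈ S, ∑ _a : κ, ‖v‖ * ‖w‖ := Finset.sum_le_sum fun p _ => Finset.sum_le_sum fun a _ => by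
          rw [abs_mul]
          exact mul_le_mul (abs_apply_apply_le_norm v p a) (abs_apply_apply_le_norm w p a) (abs_nonneg _)
            (norm_nonneg _)
      _ = (S.card * Fintype.card κ : ℝ) * ‖v‖ * ‖w‖ := by
          simp only [Finset.sum_const, Finset.card_univ, nsmul_eq_mul]; ring
  calc 2 * |∑ p ∈ S, ∑ a, v p a * w p a| ≤ 2 * ((S.card * Fintype.card κ : ℝ) * ‖v‖ * ‖w‖) :=
        mul_le_mul_of_nonneg_left h zero_le_two
    _ = _ := by ring

/-- `|A_S y w| ≤ 2 (Σ_{p∈S,a} |y_{pa}|) ‖w‖`. [folklore] -/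
theorem abs_linField_apply_apply_le' (y w : ι → κ → ℝ) :
    |((-2 : ℝ) • ∑ p ∈ S, ∑ a : κ, ((ContinuousLinearMap.proj (R := ℝ) a).comp
        (ContinuousLinearMap.proj (R := ℝ) (φ := fun _ : ι => κ → ℝ) p)).smulRight
        ((ContinuousLinearMap.proj (R := ℝ) a).comp
          (ContinuousLinearMap.proj (R := ℝ) (φ := fun _ : ι => κ → ℝ) p))) y w| ≤ 2 * (∑ p ∈ S, ∑ a, |y p a|) * ‖w‖ := by
  rw [linField_apply_apply, abs_mul, abs_neg, abs_two]
  have h : |∑ p ∈ S, ∑ a, y p a * w p a| ≤ (∑ p ∈ S, ∑ a, |y p a|) * ‖w‖ := by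
    refine (Finset.abs_sum_le_sum_abs _ _).trans ?_
    calc ∑ p ∈ S, |∑ a, y p a * w p a| ≤ ∑ p ∈ S, ∑ a, |y p a * w p a| :=
          Finset.sum_le_sum fun p _ => Finset.abs_sum_le_sum_abs _ _
      _ ≤ ∑ p ∈ S, ∑ a, |y p a| * ‖w‖ := Finset.sum_le_sum fun p _ => Finset.sum_le_sum fun a _ => by
          rw [abs_mul]
          exact mul_le_mul_of_nonneg_left (abs_apply_apply_le_norm w p a) (abs_nonneg _)
      _ = (∑ p ∈ S, ∑ a, |y p a|) * ‖w‖ := by simp [Finset.sum_mul]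
  calc 2 * |∑ p ∈ S, ∑ a, y p a * w p a| ≤ 2 * ((∑ p ∈ S, ∑ a, |y p a|) * ‖w‖) :=
        mul_le_mul_of_nonneg_left h zero_le_two
    _ = _ := by ring

/-- **First derivative of the Gaussian test function** `h_S = exp(-q_S)`: `Dh_S(y) = h_S(y) · A_S y`. [cite: Meckes2009, §1] -/
theorem hasFDerivAt_gaussTest (y : ι → κ → ℝ) :
    HasFDerivAt (fun y : ι → κ → ℝ => Real.exp (-∑ p ∈ S, ∑ a, (y p a) ^ 2))
      (Real.exp (-∑ p ∈ S, ∑ a, (y p a) ^ 2) • ((-2 : ℝ) • ∑ p ∈ S, ∑ a : κ, ((ContinuousLinearMap.proj (R := ℝ) a).comp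
        (ContinuousLinearMap.proj (R := ℝ) (φ := fun _ : ι => κ → ℝ) p)).smulRight
        ((ContinuousLinearMap.proj (R := ℝ) a).comp
          (ContinuousLinearMap.proj (R := ℝ) (φ := fun _ : ι => κ → ℝ) p))) y) y := by
  rw [linField_apply]
  exact (hasFDerivAt_sqSum S y).neg.exp

/-- `fderiv` form of `hasFDerivAt_gaussTest`. [cite: Meckes2009, §1] -/
theorem fderiv_gaussTest :
    fderiv ℝ (fun y : ι → κ → ℝ => Real.exp (-∑ p ∈ S, ∑ a, (y p a) ^ 2)) = fun y =>
      Real.exp (-∑ p ∈ S, ∑ a, (y p a) ^ 2) • ((-2 : ℝ) • ∑ p ∈ S, ∑ a : κ, ((ContinuousLinearMap.proj (R := ℝ) a).comp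
        (ContinuousLinearMap.proj (R := ℝ) (φ := fun _ : ι => κ → ℝ) p)).smulRight
        ((ContinuousLinearMap.proj (R := ℝ) a).comp
          (ContinuousLinearMap.proj (R := ℝ) (φ := fun _ : ι => κ → ℝ) p))) y :=
  funext fun y => (hasFDerivAt_gaussTest S y).fderiv

/-- **Second derivative of the Gaussian test function**: `D²h_S(y) = h_S(y) · A_S + (h_S(y) A_S y) ⊗ A_S y`. [cite: Meckes2009, §1] -/
theorem hasFDerivAt_fderiv_gaussTest (y : ι → κ → ℝ) :
    HasFDerivAt (fderiv ℝ (fun y : ι → κ → ℝ => Real.exp (-∑ p ∈ S, ∑ a, (y p a) ^ 2)))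
      (Real.exp (-∑ p ∈ S, ∑ a, (y p a) ^ 2) • ((-2 : ℝ) • ∑ p ∈ S, ∑ a : κ, ((ContinuousLinearMap.proj (R := ℝ) a).comp
        (ContinuousLinearMap.proj (R := ℝ) (φ := fun _ : ι => κ → ℝ) p)).smulRight
        ((ContinuousLinearMap.proj (R := ℝ) a).comp
          (ContinuousLinearMap.proj (R := ℝ) (φ := fun _ : ι => κ → ℝ) p))) +
        (Real.exp (-∑ p ∈ S, ∑ a, (y p a) ^ 2) • ((-2 : ℝ) • ∑ p ∈ S, ∑ a : κ, ((ContinuousLinearMap.proj (R := ℝ) a).comp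
        (ContinuousLinearMap.proj (R := ℝ) (φ := fun _ : ι => κ → ℝ) p)).smulRight
        ((ContinuousLinearMap.proj (R := ℝ) a).comp
          (ContinuousLinearMap.proj (R := ℝ) (φ := fun _ : ι => κ → ℝ) p))) y).smulRight (((-2 : ℝ) • ∑ p ∈ S, ∑ a : κ, ((ContinuousLinearMap.proj (R := ℝ) a).comp
        (ContinuousLinearMap.proj (R := ℝ) (φ := fun _ : ι => κ → ℝ) p)).smulRight
        ((ContinuousLinearMap.proj (R := ℝ) a).comp
          (ContinuousLinearMap.proj (R := ℝ) (φ := fun _ : ι => κ → ℝ) p))) y)) y := by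
  rw [fderiv_gaussTest]
  exact (hasFDerivAt_gaussTest S y).fun_smul (ContinuousLinearMap.hasFDerivAt _)

/-- The first derivative on a vector: `Dh_S(y)[w] = h_S(y) · A_S y w`. [cite: Meckes2009, §1] -/
theorem fderiv_gaussTest_apply (y w : ι → κ → ℝ) :
    fderiv ℝ (fun y : ι → κ → ℝ => Real.exp (-∑ p ∈ S, ∑ a, (y p a) ^ 2)) y w = Real.exp (-∑ p ∈ S, ∑ a, (y p a) ^ 2) * ((-2 : ℝ) • ∑ p ∈ S, ∑ a : κ, ((ContinuousLinearMap.proj (R := ℝ) a).comp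
        (ContinuousLinearMap.proj (R := ℝ) (φ := fun _ : ι => κ → ℝ) p)).smulRight
        ((ContinuousLinearMap.proj (R := ℝ) a).comp
          (ContinuousLinearMap.proj (R := ℝ) (φ := fun _ : ι => κ → ℝ) p))) y w := by
  rw [fderiv_gaussTest]
  rfl

/-- The second derivative on two vectors: `D²h_S(y)[v][w] = h_S(y)(A_S v w + (A_S y v)(A_S y w))`. [cite: Meckes2009, §1] -/
theorem fderiv_fderiv_gaussTest_apply (y v w : ι → κ → ℝ) :
    fderiv ℝ (fderiv ℝ (fun y : ι → κ → ℝ => Real.exp (-∑ p ∈ S, ∑ a, (y p a) ^ 2))) y v w =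
      Real.exp (-∑ p ∈ S, ∑ a, (y p a) ^ 2) * ((-2 : ℝ) • ∑ p ∈ S, ∑ a : κ, ((ContinuousLinearMap.proj (R := ℝ) a).comp
        (ContinuousLinearMap.proj (R := ℝ) (φ := fun _ : ι => κ → ℝ) p)).smulRight
        ((ContinuousLinearMap.proj (R := ℝ) a).comp
          (ContinuousLinearMap.proj (R := ℝ) (φ := fun _ : ι => κ → ℝ) p))) v w +
        Real.exp (-∑ p ∈ S, ∑ a, (y p a) ^ 2) * ((-2 : ℝ) • ∑ p ∈ S, ∑ a : κ, ((ContinuousLinearMap.proj (R := ℝ) a).comp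
        (ContinuousLinearMap.proj (R := ℝ) (φ := fun _ : ι => κ → ℝ) p)).smulRight
        ((ContinuousLinearMap.proj (R := ℝ) a).comp
          (ContinuousLinearMap.proj (R := ℝ) (φ := fun _ : ι => κ → ℝ) p))) y v * ((-2 : ℝ) • ∑ p ∈ S, ∑ a : κ, ((ContinuousLinearMap.proj (R := ℝ) a).comp
        (ContinuousLinearMap.proj (R := ℝ) (φ := fun _ : ι => κ → ℝ) p)).smulRight
        ((ContinuousLinearMap.proj (R := ℝ) a).comp
          (ContinuousLinearMap.proj (R := ℝ) (φ := fun _ : ι => κ → ℝ) p))) y w := by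
  rw [(hasFDerivAt_fderiv_gaussTest S y).fderiv]
  simp [mul_comm, mul_assoc, mul_left_comm]

omit [Fintype ι] in
/-- Cauchy–Schwarz: `(Σ_{p∈S,a} |y p a|)² ≤ |S|·|κ| · Σ_{p∈S,a} (y p a)²`. [folklore] -/
theorem sq_sum_abs_le (y : ι → κ → ℝ) :
    (∑ p ∈ S, ∑ a, |y p a|) ^ 2 ≤ (S.card * Fintype.card κ : ℝ) * ∑ p ∈ S, ∑ a, (y p a) ^ 2 := by
  have h := sq_sum_le_card_mul_sum_sq (s := S ×ˢ (Finset.univ : Finset κ)) (f := fun s => |y s.1 s.2|)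
  rw [Finset.sum_product, Finset.sum_product, Finset.card_product, Finset.card_univ] at h
  simp only [sq_abs, Nat.cast_mul] at h
  exact h

/-- **Global bound on the first derivative**: `‖Dh_S(y)‖ ≤ |S||κ| + 1`. [cite: Meckes2009, §1] -/
theorem norm_fderiv_gaussTest_le (y : ι → κ → ℝ) :
    ‖fderiv ℝ (fun y : ι → κ → ℝ => Real.exp (-∑ p ∈ S, ∑ a, (y p a) ^ 2)) y‖ ≤ (S.card * Fintype.card κ : ℝ) + 1 := by
  set m : ℝ := (S.card * Fintype.card κ : ℝ) with hm
  set q : ℝ := ∑ p ∈ S, ∑ a, (y p a) ^ 2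
  set s₁ : ℝ := ∑ p ∈ S, ∑ a, |y p a|
  have hm0 : 0 ≤ m := by positivity
  have hq0 : 0 ≤ q := Finset.sum_nonneg fun p _ => Finset.sum_nonneg fun a _ => sq_nonneg _
  have hs0 : 0 ≤ s₁ := Finset.sum_nonneg fun p _ => Finset.sum_nonneg fun a _ => abs_nonneg _
  have hcs : s₁ ^ 2 ≤ m * q := sq_sum_abs_le S y
  have he0 : 0 < Real.exp (-q) := Real.exp_pos _
  have hqe : q * Real.exp (-q) ≤ 1 := by
    rw [Real.exp_neg, mul_inv_le_iff₀ (Real.exp_pos q), one_mul]; linarith [Real.add_one_le_exp q]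
  -- `s₁ ≤ (m + q)/2` from `s₁² ≤ m q ≤ ((m+q)/2)²`
  have hs1 : s₁ ≤ (m + q) / 2 := by
    have h : s₁ ^ 2 ≤ ((m + q) / 2) ^ 2 := hcs.trans (by nlinarith [sq_nonneg (m - q)])
    exact (pow_le_pow_iff_left₀ hs0 (by positivity) two_ne_zero).mp h
  have hkey : Real.exp (-q) * (2 * s₁) ≤ m + 1 :=
    calc Real.exp (-q) * (2 * s₁) ≤ Real.exp (-q) * (m + q) := mul_le_mul_of_nonneg_left (by linarith) he0.le
      _ = m * Real.exp (-q) + q * Real.exp (-q) := by ring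
      _ ≤ m * 1 + 1 := add_le_add (mul_le_mul_of_nonneg_left (Real.exp_le_one_iff.mpr (by linarith)) hm0) hqe
      _ = m + 1 := by ring
  refine ContinuousLinearMap.opNorm_le_bound _ (by positivity) fun w => ?_
  rw [fderiv_gaussTest_apply, Real.norm_eq_abs, abs_mul, abs_of_pos he0]
  calc Real.exp (-q) * |((-2 : ℝ) • ∑ p ∈ S, ∑ a : κ, ((ContinuousLinearMap.proj (R := ℝ) a).comp
        (ContinuousLinearMap.proj (R := ℝ) (φ := fun _ : ι => κ → ℝ) p)).smulRight
        ((ContinuousLinearMap.proj (R := ℝ) a).comp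
          (ContinuousLinearMap.proj (R := ℝ) (φ := fun _ : ι => κ → ℝ) p))) y w| ≤ Real.exp (-q) * (2 * s₁ * ‖w‖) :=
        mul_le_mul_of_nonneg_left (abs_linField_apply_apply_le' S y w) he0.le
    _ = Real.exp (-q) * (2 * s₁) * ‖w‖ := by ring
    _ ≤ (m + 1) * ‖w‖ := mul_le_mul_of_nonneg_right hkey (norm_nonneg _)

/-- **Global bound on the second derivative**: `|D²h_S(y)[v][w]| ≤ 6 |S||κ| ‖v‖ ‖w‖`. [cite: Meckes2009, §1] -/
theorem abs_fderiv_fderiv_gaussTest_le (y v w : ι → κ → ℝ) :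
    |fderiv ℝ (fderiv ℝ (fun y : ι → κ → ℝ => Real.exp (-∑ p ∈ S, ∑ a, (y p a) ^ 2))) y v w| ≤ 6 * (S.card * Fintype.card κ : ℝ) * ‖v‖ * ‖w‖ := by
  set m : ℝ := (S.card * Fintype.card κ : ℝ) with hm
  set q : ℝ := ∑ p ∈ S, ∑ a, (y p a) ^ 2
  set s₁ : ℝ := ∑ p ∈ S, ∑ a, |y p a|
  have hm0 : 0 ≤ m := by positivity
  have hq0 : 0 ≤ q := Finset.sum_nonneg fun p _ => Finset.sum_nonneg fun a _ => sq_nonneg _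
  have hs0 : 0 ≤ s₁ := Finset.sum_nonneg fun p _ => Finset.sum_nonneg fun a _ => abs_nonneg _
  have hcs : s₁ ^ 2 ≤ m * q := sq_sum_abs_le S y
  have he0 : 0 < Real.exp (-q) := Real.exp_pos _
  have he1 : Real.exp (-q) ≤ 1 := Real.exp_le_one_iff.mpr (by linarith)
  have hqe : q * Real.exp (-q) ≤ 1 := by
    rw [Real.exp_neg, mul_inv_le_iff₀ (Real.exp_pos q), one_mul]; linarith [Real.add_one_le_exp q]
  have hv0 := norm_nonneg v
  have hw0 := norm_nonneg w
  have h1 : |Real.exp (-q) * ((-2 : ℝ) • ∑ p ∈ S, ∑ a : κ, ((ContinuousLinearMap.proj (R := ℝ) a).comp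
        (ContinuousLinearMap.proj (R := ℝ) (φ := fun _ : ι => κ → ℝ) p)).smulRight
        ((ContinuousLinearMap.proj (R := ℝ) a).comp
          (ContinuousLinearMap.proj (R := ℝ) (φ := fun _ : ι => κ → ℝ) p))) v w| ≤ 2 * m * ‖v‖ * ‖w‖ := by
    rw [abs_mul, abs_of_pos he0]
    calc Real.exp (-q) * |((-2 : ℝ) • ∑ p ∈ S, ∑ a : κ, ((ContinuousLinearMap.proj (R := ℝ) a).comp
        (ContinuousLinearMap.proj (R := ℝ) (φ := fun _ : ι => κ → ℝ) p)).smulRight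
        ((ContinuousLinearMap.proj (R := ℝ) a).comp
          (ContinuousLinearMap.proj (R := ℝ) (φ := fun _ : ι => κ → ℝ) p))) v w| ≤ 1 * (2 * m * ‖v‖ * ‖w‖) :=
          mul_le_mul he1 (abs_linField_apply_apply_le S v w) (abs_nonneg _) zero_le_one
      _ = _ := one_mul _
  have h2 : |Real.exp (-q) * ((-2 : ℝ) • ∑ p ∈ S, ∑ a : κ, ((ContinuousLinearMap.proj (R := ℝ) a).comp
        (ContinuousLinearMap.proj (R := ℝ) (φ := fun _ : ι => κ → ℝ) p)).smulRight
        ((ContinuousLinearMap.proj (R := ℝ) a).comp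
          (ContinuousLinearMap.proj (R := ℝ) (φ := fun _ : ι => κ → ℝ) p))) y v * ((-2 : ℝ) • ∑ p ∈ S, ∑ a : κ, ((ContinuousLinearMap.proj (R := ℝ) a).comp
        (ContinuousLinearMap.proj (R := ℝ) (φ := fun _ : ι => κ → ℝ) p)).smulRight
        ((ContinuousLinearMap.proj (R := ℝ) a).comp
          (ContinuousLinearMap.proj (R := ℝ) (φ := fun _ : ι => κ → ℝ) p))) y w| ≤ 4 * m * ‖v‖ * ‖w‖ := by
    rw [abs_mul, abs_mul, abs_of_pos he0]
    have hyv := abs_linField_apply_apply_le' S y v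
    have hyw := abs_linField_apply_apply_le' S y w
    calc Real.exp (-q) * |((-2 : ℝ) • ∑ p ∈ S, ∑ a : κ, ((ContinuousLinearMap.proj (R := ℝ) a).comp
        (ContinuousLinearMap.proj (R := ℝ) (φ := fun _ : ι => κ → ℝ) p)).smulRight
        ((ContinuousLinearMap.proj (R := ℝ) a).comp
          (ContinuousLinearMap.proj (R := ℝ) (φ := fun _ : ι => κ → ℝ) p))) y v| * |((-2 : ℝ) • ∑ p ∈ S, ∑ a : κ, ((ContinuousLinearMap.proj (R := ℝ) a).comp
        (ContinuousLinearMap.proj (R := ℝ) (φ := fun _ : ι => κ → ℝ) p)).smulRight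
        ((ContinuousLinearMap.proj (R := ℝ) a).comp
          (ContinuousLinearMap.proj (R := ℝ) (φ := fun _ : ι => κ → ℝ) p))) y w|
        ≤ Real.exp (-q) * (2 * s₁ * ‖v‖) * (2 * s₁ * ‖w‖) :=
          mul_le_mul (mul_le_mul_of_nonneg_left hyv he0.le) hyw (abs_nonneg _) (by positivity)
      _ = 4 * (q * Real.exp (-q)) * 0 + 4 * (s₁ ^ 2 * Real.exp (-q)) * (‖v‖ * ‖w‖) := by ring
      _ ≤ 4 * (q * Real.exp (-q)) * 0 + 4 * (m * q * Real.exp (-q)) * (‖v‖ * ‖w‖) := by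
          gcongr
      _ = 4 * m * (q * Real.exp (-q)) * (‖v‖ * ‖w‖) := by ring
      _ ≤ 4 * m * 1 * (‖v‖ * ‖w‖) := by gcongr
      _ = 4 * m * ‖v‖ * ‖w‖ := by ring
  rw [fderiv_fderiv_gaussTest_apply]
  exact (abs_add_le _ _).trans (by linarith)

/-- `‖D²h_S(y)‖ ≤ 6 |S||κ|` for the second Fréchet derivative as a bilinear map (`iteratedFDeriv ℝ 2`). [cite: Meckes2009, §1] -/
theorem norm_iteratedFDeriv_two_gaussTest_le (y : ι → κ → ℝ) :
    ‖iteratedFDeriv ℝ 2 (fun y : ι → κ → ℝ => Real.exp (-∑ p ∈ S, ∑ a, (y p a) ^ 2)) y‖ ≤ 6 * (S.card * Fintype.card κ : ℝ) := by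
  refine ContinuousMultilinearMap.opNorm_le_bound (by positivity) fun m => ?_
  rw [iteratedFDeriv_two_apply, Fin.prod_univ_two, Real.norm_eq_abs]
  calc |fderiv ℝ (fderiv ℝ (fun y : ι → κ → ℝ => Real.exp (-∑ p ∈ S, ∑ a, (y p a) ^ 2))) y (m 0) (m 1)| ≤ 6 * (S.card * Fintype.card κ : ℝ) * ‖m 0‖ * ‖m 1‖ :=
        abs_fderiv_fderiv_gaussTest_le S y _ _
    _ = 6 * (S.card * Fintype.card κ : ℝ) * (‖m 0‖ * ‖m 1‖) := by ring

/-- The Gaussian test function is smooth. [folklore] -/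
theorem contDiff_gaussTest {n : WithTop ℕ∞} : ContDiff ℝ n (fun y : ι → κ → ℝ => Real.exp (-∑ p ∈ S, ∑ a, (y p a) ^ 2)) := by
  refine Real.contDiff_exp.comp (ContDiff.neg (ContDiff.sum fun p _ => ContDiff.sum fun a _ => ?_))
  exact (((ContinuousLinearMap.proj (R := ℝ) a).comp
        (ContinuousLinearMap.proj (R := ℝ) (φ := fun _ : ι => κ → ℝ) p)).contDiff).pow 2

/-- **Admissibility of the scaled Gaussian test functions.** With `c = 6|S||κ| + 1`, the function
`h(y) = c⁻¹ · exp(-Σ_{p∈S} Σ_a (y p a)²)` is `C^∞` with `‖∇h‖ ≤ 1` and `‖∇²h‖ ≤ 1` everywhere (operator norms for the sup norm of the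
block space). [cite: Meckes2009, §1] -/
theorem gaussTest_admissible :
    ContDiff ℝ (⊤ : ℕ∞) (fun y : ι → κ → ℝ =>
        (6 * (S.card * Fintype.card κ : ℝ) + 1)⁻¹ * Real.exp (-∑ p ∈ S, ∑ a, (y p a) ^ 2)) ∧
      (∀ y, ‖fderiv ℝ (fun y : ι → κ → ℝ =>
        (6 * (S.card * Fintype.card κ : ℝ) + 1)⁻¹ * Real.exp (-∑ p ∈ S, ∑ a, (y p a) ^ 2)) y‖ ≤ 1) ∧
      (∀ y, ‖iteratedFDeriv ℝ 2 (fun y : ι → κ → ℝ =>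
        (6 * (S.card * Fintype.card κ : ℝ) + 1)⁻¹ * Real.exp (-∑ p ∈ S, ∑ a, (y p a) ^ 2)) y‖ ≤ 1) := by
  set m : ℝ := (S.card * Fintype.card κ : ℝ) with hm
  set c : ℝ := 6 * m + 1 with hc
  have hm0 : 0 ≤ m := by positivity
  have hc0 : 0 < c := by positivity
  have hcinv : 0 < c⁻¹ := inv_pos.mpr hc0
  have hsmooth : ∀ {n : WithTop ℕ∞}, ContDiff ℝ n (fun y : ι → κ → ℝ => Real.exp (-∑ p ∈ S, ∑ a, (y p a) ^ 2)) := contDiff_gaussTest S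
  have hdiff : Differentiable ℝ (fun y : ι → κ → ℝ => Real.exp (-∑ p ∈ S, ∑ a, (y p a) ^ 2)) := (hsmooth (n := 1)).differentiable one_ne_zero
  have hfun : (fun y : ι → κ → ℝ => c⁻¹ * Real.exp (-∑ p ∈ S, ∑ a, (y p a) ^ 2)) =
      fun y => c⁻¹ • Real.exp (-∑ p ∈ S, ∑ a, (y p a) ^ 2) := rfl
  refine ⟨contDiff_const.mul hsmooth, fun y => ?_, fun y => ?_⟩
  · rw [fderiv_const_mul (hdiff y)]
    refine ContinuousLinearMap.opNorm_le_bound _ zero_le_one fun w => ?_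
    rw [one_mul]
    calc ‖(c⁻¹ • fderiv ℝ (fun y : ι → κ → ℝ => Real.exp (-∑ p ∈ S, ∑ a, (y p a) ^ 2)) y) w‖ = c⁻¹ * ‖fderiv ℝ (fun y : ι → κ → ℝ => Real.exp (-∑ p ∈ S, ∑ a, (y p a) ^ 2)) y w‖ := by
          rw [show (c⁻¹ • fderiv ℝ (fun y : ι → κ → ℝ => Real.exp (-∑ p ∈ S, ∑ a, (y p a) ^ 2)) y) w = c⁻¹ • fderiv ℝ (fun y : ι → κ → ℝ => Real.exp (-∑ p ∈ S, ∑ a, (y p a) ^ 2)) y w from rfl, norm_smul,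
            Real.norm_of_nonneg hcinv.le]
      _ ≤ c⁻¹ * ((m + 1) * ‖w‖) := mul_le_mul_of_nonneg_left
          ((ContinuousLinearMap.le_opNorm _ w).trans
            (mul_le_mul_of_nonneg_right (norm_fderiv_gaussTest_le S y) (norm_nonneg _))) hcinv.le
      _ ≤ ‖w‖ := by
          rw [← mul_assoc]
          refine mul_le_of_le_one_left (norm_nonneg _) ?_
          rw [inv_mul_le_iff₀ hc0]; linarith
  · rw [hfun, iteratedFDeriv_const_smul_apply' ((hsmooth (n := 2)).contDiffAt)]
    refine ContinuousMultilinearMap.opNorm_le_bound zero_le_one fun v => ?_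
    rw [one_mul, show (c⁻¹ • iteratedFDeriv ℝ 2 (fun y : ι → κ → ℝ => Real.exp (-∑ p ∈ S, ∑ a, (y p a) ^ 2)) y) v = c⁻¹ • iteratedFDeriv ℝ 2 (fun y : ι → κ → ℝ => Real.exp (-∑ p ∈ S, ∑ a, (y p a) ^ 2)) y v from rfl,
      norm_smul, Real.norm_of_nonneg hcinv.le]
    calc c⁻¹ * ‖iteratedFDeriv ℝ 2 (fun y : ι → κ → ℝ => Real.exp (-∑ p ∈ S, ∑ a, (y p a) ^ 2)) y v‖ ≤ c⁻¹ * (6 * m * ∏ i, ‖v i‖) :=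
          mul_le_mul_of_nonneg_left ((ContinuousMultilinearMap.le_opNorm _ v).trans
            (mul_le_mul_of_nonneg_right (norm_iteratedFDeriv_two_gaussTest_le S y)
              (Finset.prod_nonneg fun i _ => norm_nonneg _))) hcinv.le
      _ ≤ ∏ i, ‖v i‖ := by
          rw [← mul_assoc]
          refine mul_le_of_le_one_left (Finset.prod_nonneg fun i _ => norm_nonneg _) ?_
          rw [inv_mul_le_iff₀ hc0]; linarith

end Test

/-! ### The Gaussian side: the probe covariance under the block law -/

section Gauss

variable (B : Finset (ZdPlaquette 4)) (D : ℕ)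

/-- Transport of the two-plaquette Gaussian moment to the block law:
`∫ e^{-|y_p|²} e^{-|y_q|²} dγ_B = ∫ e^{-|Y_p|²} e^{-|Y_q|²} d(curvatureGaussianField 4 D)`. [cite: GarbanSepulveda2023, §4 Proposition (law of the gradient spin-wave)] -/
theorem integral_gauss_mul_gauss_blockLaw (p q : ↥B) :
    ∫ y, Real.exp (-∑ a, (y p a) ^ 2) * Real.exp (-∑ a, (y q a) ^ 2) ∂latticeMaxwellBlockLaw B D =
      ∫ Y, Real.exp (-∑ a, (Y (p : ZdPlaquette 4) a) ^ 2) * Real.exp (-∑ a, (Y (q : ZdPlaquette 4) a) ^ 2)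
        ∂curvatureGaussianField 4 D := by
  rw [integral_latticeMaxwellBlockLaw B D _ (Continuous.aestronglyMeasurable (by fun_prop))]
  rfl

/-- Transport of the one-plaquette Gaussian moment to the block law. [cite: GarbanSepulveda2023, §4 Proposition (law of the gradient spin-wave)] -/
theorem integral_gauss_blockLaw (p : ↥B) :
    ∫ y, Real.exp (-∑ a, (y p a) ^ 2) ∂latticeMaxwellBlockLaw B D =
      ∫ Y, Real.exp (-∑ a, (Y (p : ZdPlaquette 4) a) ^ 2) ∂curvatureGaussianField 4 D := by
  rw [integral_latticeMaxwellBlockLaw B D _ (Continuous.aestronglyMeasurable (by fun_prop))]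
  rfl

/-- **The Gaussian covariance of the probes under the block law**:
`Cov_{γ_B}(e^{-|y_p|²}, e^{-|y_q|²}) = 2^{-D}((1 − c²)^{-D/2} − 1)`, `c = curvatureTwoPoint p q`. [cite: GarbanSepulveda2023, §4 Proposition (law of the gradient spin-wave)] -/
theorem gauss_covariance_blockLaw (p q : ↥B) :
    (∫ y, Real.exp (-∑ a, (y p a) ^ 2) * Real.exp (-∑ a, (y q a) ^ 2) ∂latticeMaxwellBlockLaw B D) -
        (∫ y, Real.exp (-∑ a, (y p a) ^ 2) ∂latticeMaxwellBlockLaw B D) *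
          (∫ y, Real.exp (-∑ a, (y q a) ^ 2) ∂latticeMaxwellBlockLaw B D) =
      (2 : ℝ) ^ (-(D : ℝ)) *
        ((1 - curvatureTwoPoint (p : ZdPlaquette 4) (q : ZdPlaquette 4) ^ 2) ^ (-((D : ℝ) / 2)) - 1) := by
  rw [integral_gauss_mul_gauss_blockLaw, integral_gauss_blockLaw, integral_gauss_blockLaw]
  exact EquipartitionPinsProbe.GaussianProfile.covariance_formula D _ _

/-- `0 ≤ ∫ e^{-|y_p|²} dγ_B ≤ 1` (`γ_B` is a probability measure, the integrand is in `[0,1]`). [folklore] -/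
theorem integral_gauss_blockLaw_mem (p : ↥B) :
    0 ≤ ∫ y, Real.exp (-∑ a, (y p a) ^ 2) ∂latticeMaxwellBlockLaw B D ∧
      ∫ y, Real.exp (-∑ a, (y p a) ^ 2) ∂latticeMaxwellBlockLaw B D ≤ 1 := by
  haveI := isProbabilityMeasure_latticeMaxwellBlockLaw B D (by norm_num : 3 ≤ 4)
  refine ⟨integral_nonneg fun y => (Real.exp_pos _).le, ?_⟩
  calc ∫ y, Real.exp (-∑ a, (y p a) ^ 2) ∂latticeMaxwellBlockLaw B D
      ≤ ∫ _y, (1 : ℝ) ∂latticeMaxwellBlockLaw B D :=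
        integral_mono_of_nonneg (ae_of_all _ fun y => (Real.exp_pos _).le) (integrable_const _)
          (ae_of_all _ fun y => Real.exp_le_one_iff.mpr (by
            have := Finset.sum_nonneg (fun a (_ : a ∈ Finset.univ) => sq_nonneg (y p a)); linarith))
    _ = 1 := by simp

end Gauss

end ProbeCovFromPairLaw

end Summit.QuantumFields.YangMills.Theorems.SteinGapBootstrap

end
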